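import Mathlib
import HarnessLib
import Summits.HubbardSuperconductivity.HubbardSuperconductivity.Theorems.KLProgrammeKLRegimeSymbolAngularFactorSingle
import Summits.HubbardSuperconductivity.HubbardSuperconductivity.Theorems.KLProgrammeKLRegimeSymbolLineDerivThree

/-!
# Route `KLProgramme` — engine support, route (L2) symbol layer: line derivatives of the TWO-SCALE two-sector angular factor
# `Z = χ_sq χ_sq·(Rζ̃_{n₁,ω₁})(Rζ̃_{n₂,ω₂})` up to ORDER THREE

Cell `gate-hubbard-kl`, seat p3 (g10); program «W2 = weighted overlap rows» (KL STATUS 2026-08-27 19:05Z), file W2a.  p4's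
`abs_derivs_angularFactor_line_le` (`…SymbolAngularFactor`) gives orders `≤ 2` of the pair angular factor at two angular scales `n₁, n₂`;
`abs_derivs3_angularFactor_line_le` (`…FatAngularFactorThird`, p558281) gives order `3` at EQUAL scales.  The weighted twin of
`charSum_klAnisoPair_le_uniform` (thin pairs at neighbouring scales `(n₁, n₂)`) needs order `3` at two scales:

* **`abs_derivs3_angularFactorPair_line_le`** — at a point `p₀ + s•w` of the open square with `‖·‖ ≥ 1`, with `B` the constant of
  `exists_norm_iteratedDeriv_sectorWeightCirc_polarAngle_line_le 3` and `D_i = (1 + 6/w_{n_i})‖w₁ + iw₂‖`: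
  `|∂ₛZ| ≤ 6B(D₁ + D₂)`, `|∂ₛ²Z| ≤ 6B(D₁² + D₂²) + 72B²D₁D₂`, `|∂ₛ³Z| ≤ 6B(D₁³ + D₂³) + 108B²(D₁²D₂ + D₁D₂²)`.

Everything is proved; no definitions, no named facts. [folklore] (BGM 2006 §2.5 Lemma 2.2.)
-/

noncomputable section

namespace Summit.HubbardSuperconductivity.HubbardSuperconductivity.Theorems.TorusFourierL2

set_option linter.dupNamespace false -- summit = problem name (single-conjunct summit), D-0017

open Set Filter Topology Complex Literature.MathematicalPhysics.QuantumLattice Literature.Analysis.SpecialFunctions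
open scoped Real Nat

/-- **Line derivatives of the two-scale two-sector angular factor up to order three** at a point `p₀ + s•w` of the open square with
`‖·‖ ≥ 1`: `|∂ₛZ| ≤ 6B(D₁+D₂)`, `|∂ₛ²Z| ≤ 6B(D₁²+D₂²) + 72B²D₁D₂`, `|∂ₛ³Z| ≤ 6B(D₁³+D₂³) + 108B²(D₁²D₂ + D₁D₂²)`, `D_i = (1 + 6/w_{n_i})‖w₁+iw₂‖`.
[cite: BenfattoGiulianiMastropietro2006, §2.5 Lemma 2.2] -/
theorem abs_derivs3_angularFactorPair_line_le {z : ℝ} (hz : 0 < z) {n₁ n₂ : ℕ} {ω₁ ω₂ : ℤ} {Z : (Fin 2 → ℝ) → ℝ}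
    (hZ : ∀ p, Z p = gnCutoff ((π + z) ^ 2 / π ^ 2) ((π + z) ^ 2) (p 0 ^ 2) * gnCutoff ((π + z) ^ 2 / π ^ 2) ((π + z) ^ 2) (p 1 ^ 2) *
      ((radialCutoffC (1 / 2) (momToComplex p) * sectorWeightCirc n₁ ω₁ (polarAngle p)) *
        (radialCutoffC (1 / 2) (momToComplex p) * sectorWeightCirc n₂ ω₂ (polarAngle p))))
    {B : ℝ} (hB0 : 0 ≤ B)
    (hB : ∀ (i : ℕ), i ≤ 3 → ∀ (n : ℕ) (ω : ℤ) (θ₀ : ℝ) (q w : Fin 2 → ℝ) (t : ℝ) {r₀ : ℝ}, 0 < r₀ →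
      r₀ ≤ ‖momToComplex (q + t • w)‖ → |sectorRelAngle θ₀ (q + t • w)| < π →
      ‖iteratedDeriv i (fun t : ℝ => sectorWeightCirc n ω (polarAngle (q + t • w))) t‖ ≤
        (3 : ℕ)! * B * ((1 + (sectorWidth n)⁻¹ * (3 : ℕ)!) * ‖momToComplex w‖ / r₀) ^ i)
    (p₀ w : Fin 2 → ℝ) {s : ℝ} (hsq : ∀ i, |(p₀ + s • w) i| < π) (hfermi : 1 ≤ ‖momToComplex (p₀ + s • w)‖) :
    |deriv (fun σ : ℝ => Z (p₀ + σ • w)) s| ≤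
        6 * B * (((1 + 6 * (sectorWidth n₁)⁻¹) * ‖momToComplex w‖) + ((1 + 6 * (sectorWidth n₂)⁻¹) * ‖momToComplex w‖)) ∧
      |iteratedDeriv 2 (fun σ : ℝ => Z (p₀ + σ • w)) s| ≤
        6 * B * (((1 + 6 * (sectorWidth n₁)⁻¹) * ‖momToComplex w‖) ^ 2 + ((1 + 6 * (sectorWidth n₂)⁻¹) * ‖momToComplex w‖) ^ 2) +
          72 * B ^ 2 * (((1 + 6 * (sectorWidth n₁)⁻¹) * ‖momToComplex w‖) * ((1 + 6 * (sectorWidth n₂)⁻¹) * ‖momToComplex w‖)) ∧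
      |iteratedDeriv 3 (fun σ : ℝ => Z (p₀ + σ • w)) s| ≤
        6 * B * (((1 + 6 * (sectorWidth n₁)⁻¹) * ‖momToComplex w‖) ^ 3 + ((1 + 6 * (sectorWidth n₂)⁻¹) * ‖momToComplex w‖) ^ 3) +
          108 * B ^ 2 * (((1 + 6 * (sectorWidth n₁)⁻¹) * ‖momToComplex w‖) ^ 2 * ((1 + 6 * (sectorWidth n₂)⁻¹) * ‖momToComplex w‖) +
            ((1 + 6 * (sectorWidth n₁)⁻¹) * ‖momToComplex w‖) * ((1 + 6 * (sectorWidth n₂)⁻¹) * ‖momToComplex w‖) ^ 2) := by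
  set g₁ : ℝ → ℝ := fun σ => radialCutoffC (1 / 2) (momToComplex (p₀ + σ • w)) * sectorWeightCirc n₁ ω₁ (polarAngle (p₀ + σ • w))
    with hg₁
  set g₂ : ℝ → ℝ := fun σ => radialCutoffC (1 / 2) (momToComplex (p₀ + σ • w)) * sectorWeightCirc n₂ ω₂ (polarAngle (p₀ + σ • w))
    with hg₂
  set D₁ : ℝ := (1 + 6 * (sectorWidth n₁)⁻¹) * ‖momToComplex w‖ with hD₁
  set D₂ : ℝ := (1 + 6 * (sectorWidth n₂)⁻¹) * ‖momToComplex w‖ with hD₂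
  have hev := angularFactor_line_eventuallyEq hZ hz p₀ w hsq
  have hc₁ : ContDiff ℝ 3 g₁ := contDiff_plateaued_line n₁ ω₁ p₀ w
  have hc₂ : ContDiff ℝ 3 g₂ := contDiff_plateaued_line n₂ ω₂ p₀ w
  have hc₁' : ContDiff ℝ 2 g₁ := contDiff_plateaued_line n₁ ω₁ p₀ w
  have hc₂' : ContDiff ℝ 2 g₂ := contDiff_plateaued_line n₂ ω₂ p₀ w
  have hb : ∀ (n : ℕ) (ω : ℤ) (σ : ℝ), |radialCutoffC (1 / 2) (momToComplex (p₀ + σ • w)) * sectorWeightCirc n ω (polarAngle (p₀ + σ • w))| ≤ 1 := by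
    intro n ω σ
    rw [abs_mul, abs_of_nonneg (radialCutoffC_mem_Icc _ _).1, abs_of_nonneg (sectorWeightCirc_nonneg _ _ _)]
    exact mul_le_one₀ (radialCutoffC_mem_Icc _ _).2 (sectorWeightCirc_nonneg _ _ _) (sectorWeightCirc_le_one _ _ _)
  have h10 : |g₁ s| ≤ 1 := hb n₁ ω₁ s
  have h20 : |g₂ s| ≤ 1 := hb n₂ ω₂ s
  have h11 : |deriv g₁ s| ≤ 6 * B * D₁ := by
    have h := abs_iteratedDeriv_plateaued_line_le₃ hB n₁ ω₁ p₀ w hfermi (i := 1) (by norm_num)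
    rw [iteratedDeriv_one, pow_one] at h; exact h
  have h21 : |deriv g₂ s| ≤ 6 * B * D₂ := by
    have h := abs_iteratedDeriv_plateaued_line_le₃ hB n₂ ω₂ p₀ w hfermi (i := 1) (by norm_num)
    rw [iteratedDeriv_one, pow_one] at h; exact h
  have h12 : |iteratedDeriv 2 g₁ s| ≤ 6 * B * D₁ ^ 2 := abs_iteratedDeriv_plateaued_line_le₃ hB n₁ ω₁ p₀ w hfermi (i := 2) (by norm_num)
  have h22 : |iteratedDeriv 2 g₂ s| ≤ 6 * B * D₂ ^ 2 := abs_iteratedDeriv_plateaued_line_le₃ hB n₂ ω₂ p₀ w hfermi (i := 2) (by norm_num)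
  have h13 : |iteratedDeriv 3 g₁ s| ≤ 6 * B * D₁ ^ 3 := abs_iteratedDeriv_plateaued_line_le₃ hB n₁ ω₁ p₀ w hfermi (i := 3) le_rfl
  have h23 : |iteratedDeriv 3 g₂ s| ≤ 6 * B * D₂ ^ 3 := abs_iteratedDeriv_plateaued_line_le₃ hB n₂ ω₂ p₀ w hfermi (i := 3) le_rfl
  have hD₁0 : 0 ≤ D₁ := by have := sectorWidth_pos n₁; positivity
  have hD₂0 : 0 ≤ D₂ := by have := sectorWidth_pos n₂; positivity
  refine ⟨?_, ?_, ?_⟩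
  · rw [hev.deriv_eq, deriv_mul₂ hc₁' hc₂' s]
    calc _ ≤ |deriv g₁ s * g₂ s| + |g₁ s * deriv g₂ s| := abs_add_le _ _
      _ = |deriv g₁ s| * |g₂ s| + |g₁ s| * |deriv g₂ s| := by
          rw [abs_mul (deriv g₁ s) (g₂ s), abs_mul (g₁ s) (deriv g₂ s)]
      _ ≤ 6 * B * D₁ * 1 + 1 * (6 * B * D₂) :=
          add_le_add (mul_le_mul h11 h20 (abs_nonneg _) (by positivity)) (mul_le_mul h10 h21 (abs_nonneg _) zero_le_one)
      _ = 6 * B * (D₁ + D₂) := by ring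
  · rw [hev.iteratedDeriv_eq, iteratedDeriv_two_mul₂ hc₁' hc₂' s]
    calc _ ≤ |iteratedDeriv 2 g₁ s * g₂ s + 2 * (deriv g₁ s * deriv g₂ s)| + |g₁ s * iteratedDeriv 2 g₂ s| := abs_add_le _ _
      _ ≤ |iteratedDeriv 2 g₁ s * g₂ s| + |2 * (deriv g₁ s * deriv g₂ s)| + |g₁ s * iteratedDeriv 2 g₂ s| := by
          gcongr; exact abs_add_le _ _
      _ = |iteratedDeriv 2 g₁ s| * |g₂ s| + 2 * (|deriv g₁ s| * |deriv g₂ s|) + |g₁ s| * |iteratedDeriv 2 g₂ s| := by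
          rw [abs_mul (iteratedDeriv 2 g₁ s) (g₂ s), abs_mul (2 : ℝ) _, abs_mul (deriv g₁ s) (deriv g₂ s),
            abs_mul (g₁ s) (iteratedDeriv 2 g₂ s), abs_two]
      _ ≤ 6 * B * D₁ ^ 2 * 1 + 2 * ((6 * B * D₁) * (6 * B * D₂)) + 1 * (6 * B * D₂ ^ 2) := by
          refine add_le_add (add_le_add ?_ ?_) ?_
          · exact mul_le_mul h12 h20 (abs_nonneg _) (by positivity)
          · exact mul_le_mul_of_nonneg_left (mul_le_mul h11 h21 (abs_nonneg _) (by positivity)) (by norm_num)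
          · exact mul_le_mul h10 h22 (abs_nonneg _) zero_le_one
      _ = 6 * B * (D₁ ^ 2 + D₂ ^ 2) + 72 * B ^ 2 * (D₁ * D₂) := by ring
  · rw [hev.iteratedDeriv_eq, iteratedDeriv_three_mul₃ hc₁ hc₂ s]
    calc _ ≤ |iteratedDeriv 3 g₁ s * g₂ s + 3 * (iteratedDeriv 2 g₁ s * deriv g₂ s) + 3 * (deriv g₁ s * iteratedDeriv 2 g₂ s)| +
          |g₁ s * iteratedDeriv 3 g₂ s| := abs_add_le _ _
      _ ≤ |iteratedDeriv 3 g₁ s * g₂ s + 3 * (iteratedDeriv 2 g₁ s * deriv g₂ s)| + |3 * (deriv g₁ s * iteratedDeriv 2 g₂ s)| +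
          |g₁ s * iteratedDeriv 3 g₂ s| := by
          gcongr; exact abs_add_le _ _
      _ ≤ |iteratedDeriv 3 g₁ s * g₂ s| + |3 * (iteratedDeriv 2 g₁ s * deriv g₂ s)| + |3 * (deriv g₁ s * iteratedDeriv 2 g₂ s)| +
          |g₁ s * iteratedDeriv 3 g₂ s| := by
          gcongr; exact abs_add_le _ _
      _ = |iteratedDeriv 3 g₁ s| * |g₂ s| + 3 * (|iteratedDeriv 2 g₁ s| * |deriv g₂ s|) + 3 * (|deriv g₁ s| * |iteratedDeriv 2 g₂ s|) +
          |g₁ s| * |iteratedDeriv 3 g₂ s| := by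
          rw [abs_mul (iteratedDeriv 3 g₁ s) (g₂ s), abs_mul (3 : ℝ) _, abs_mul (3 : ℝ) _, abs_mul (iteratedDeriv 2 g₁ s) (deriv g₂ s),
            abs_mul (deriv g₁ s) (iteratedDeriv 2 g₂ s), abs_mul (g₁ s) (iteratedDeriv 3 g₂ s), abs_of_pos (by norm_num : (0 : ℝ) < 3)]
      _ ≤ 6 * B * D₁ ^ 3 * 1 + 3 * ((6 * B * D₁ ^ 2) * (6 * B * D₂)) + 3 * ((6 * B * D₁) * (6 * B * D₂ ^ 2)) + 1 * (6 * B * D₂ ^ 3) := by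
          refine add_le_add (add_le_add (add_le_add ?_ ?_) ?_) ?_
          · exact mul_le_mul h13 h20 (abs_nonneg _) (by positivity)
          · exact mul_le_mul_of_nonneg_left (mul_le_mul h12 h21 (abs_nonneg _) (by positivity)) (by norm_num)
          · exact mul_le_mul_of_nonneg_left (mul_le_mul h11 h22 (abs_nonneg _) (by positivity)) (by norm_num)
          · exact mul_le_mul h10 h23 (abs_nonneg _) zero_le_one
      _ = 6 * B * (D₁ ^ 3 + D₂ ^ 3) + 108 * B ^ 2 * (D₁ ^ 2 * D₂ + D₁ * D₂ ^ 2) := by ring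

end Summit.HubbardSuperconductivity.HubbardSuperconductivity.Theorems.TorusFourierL2

end
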